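import Summits.AtomisticToContinuum.HydrodynamicLimit.Theorems.BoxDissipativeWeakStrongEntropyAdmissibilityStubCruxOfFineScaleLLN
import Summits.AtomisticToContinuum.HydrodynamicLimit.Theorems.BoxDissipativeWeakStrongEntropyAdmissibilityStubFsEntropyFunctionalsLLN
import Summits.AtomisticToContinuum.HydrodynamicLimit.Theorems.BoxDissipativeWeakStrongEntropyAdmissibilityStubSmoothRenormalizedEntropyConservation
import Summits.AtomisticToContinuum.HydrodynamicLimit.Theorems.BoxDissipativeWeakStrongEntropyAdmissibilityStubClampedRenormalizedEntropyConservation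

/-!
# Crux `EntropyAdmissibility` (stmt-AtomisticToContinuum-9903), line `registered` — the crux FOLLOWS FROM THE BOX-SCALE
# HYDRODYNAMIC LIMIT IN `L¹` (the fine-scale bridge)

Route `route-AtomisticToContinuum-BoxDissipativeWeakStrong`, sub-problem `HydrodynamicLimit`, crux
`Summit.AtomisticToContinuum.HydrodynamicLimit.Theses.BoxDissipativeWeakStrong.EntropyAdmissibility` (card K2: the clamp-renormalised
LOCAL entropy inequality of Březina–Feireisl, Def. 2.9, for the law of the hard-sphere BOX state, in expectation, zero defect).

This file lands the §3 bridge theorems of the lead's skeleton r14 (`Cruxes/EntropyAdmissibility/Lines/birth.lean`). Write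
`InFrame Cptlgfs` (`EABirthFS3.Cptlgfs`) for the POSITIVE-TIME FINE-SCALE LAW OF LARGE NUMBERS in the crux's frame: at every
`t ∈ [0,T)` the box fields `(ρ̂, m̂, Ê)(t)` converge in `L¹(P_N ⊗ dx)` to the Euler state `(ρ, ρu, E(ρ,u,θ))(t,·)` — verbatim the
conclusion of the landed `LocalGibbsFineScale` (K0, `t = 0`) at time `t`; it is the box-scale hydrodynamic limit in `L¹`, OPEN and
stronger than the conjunct `HydrodynamicLimit`, and it is used here ONLY as an antecedent. From the landed wave-3 stubs FS1
(`EABirthFS1`: the two entropy functionals at time `t` converge, given that LLN at `t`; p164907), FS2a (`EABirthFS2a`: weak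
renormalised entropy CONSERVATION `∫_{(0,τ]}∫(ρZ(s)∂ₜφ + Z(s)ρu·∇φ) − ∫ρZ(s)φ|_τ + ∫ρZ(s)φ|_0 = 0` of classical hard-sphere-Euler
solutions for smooth `Z`; p165136), FS2b (`EABirthFS2b`: the same for the Lipschitz clamp `Z_{a,b}`, by mollification; p165372) and
FS3 (`EABirthFS3`: assembly; p165570):

* `inFrame_dynAbs_of_fineScaleLLN` — `InFrame Cptlgfs → InFrame CdynAbs`: under the box-scale hydrodynamic limit in `L¹`,
  `A_N → −B` in `L¹(P_N)` — the clamp-renormalised entropy balance of the box fields converges to that of the classical solution,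
  which vanishes (isentropy of smooth flows);
* `crux_of_fineScaleLLN` — `InFrame Cptlgfs → EntropyAdmissibility` (via the landed `CdynAbs ⇒ Cdyn ⇒ crux`);
* `inFrame_def_of_fineScaleLLN` — `InFrame Cptlgfs → InFrame Cdef` (the open heart S1b).

So the open content of stmt-9903 is SANDWICHED by landed theorems: `GCH ⇐ S1b ⇐ crux ⇐ InFrame Cptlgfs` (GCH necessity p158167,
S1b necessity p153795), and the typed crux is CONSISTENT with smooth Euler dynamics (zero defect along the hydrodynamic scenario) and
holds unconditionally at global equilibrium (`EABirthGE`, p162825). Packaged as the registered bookkeeping stub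
`stub_fineScaleBridge : Sig.stub_fineScaleBridge`. Nothing here restates the crux or the Statement; no `Prop` is taken as a hypothesis
of a landed claim (the bridge theorems are implications).

References: J. Březina, E. Feireisl, J. Math. Soc. Japan 70 (2018), Def. 2.9, §3.2; C. Dafermos, *Hyperbolic Conservation Laws in
Continuum Physics* (2005), §3.3.6 (smooth flows are isentropic); H. Spohn (1991), Part I Ch. 3. Lead c2
`prover-line-stmt-AtomisticToContinuum-9903-c2-0`.
-/

noncomputable section

open MeasureTheory Filter Set
open scoped ENNReal Topology

namespace Summit.AtomisticToContinuum.HydrodynamicLimit.Theorems.EABirthFS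

open Literature.MathematicalPhysics.KineticTheory
open Summit.AtomisticToContinuum.HydrodynamicLimit.Theses
open Summit.AtomisticToContinuum.HydrodynamicLimit.Theorems.BDWS
open Summit.AtomisticToContinuum.HydrodynamicLimit.Theorems.EABirthCore (Conclusion InFrame Cdyn Cdef crux_of_inFrame_dyn
  inFrame_def_of_inFrame_dyn)
open Summit.AtomisticToContinuum.HydrodynamicLimit.Theorems.EABirthGE3 (CdynAbs)
open Summit.AtomisticToContinuum.HydrodynamicLimit.Theorems.EABirthFS3 (Cptlgfs)

/-- **Under the box-scale hydrodynamic limit in `L¹`, `A_N → −B` in `L¹(P_N)`** — FS3 fed with the landed FS1 and FS2b ∘ FS2a. -/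
theorem inFrame_dynAbs_of_fineScaleLLN (h : InFrame Cptlgfs) : InFrame CdynAbs :=
  EABirthFS3.stub_cruxOfFineScaleLLN EABirthFS1.stub_fsEntropyFunctionalsLLN
    (EABirthFS2b.stub_clampedRenormalizedEntropyConservation EABirthFS2a.stub_smoothRenormalizedEntropyConservation) h

/-- **Under the box-scale hydrodynamic limit in `L¹`, the dynamic core holds**: `E[(A_N + B)⁺] ≤ E|A_N + B| → 0`. -/
theorem inFrame_dyn_of_fineScaleLLN (h : InFrame Cptlgfs) : InFrame Cdyn := by
  refine EABirthCore.InFrame.mono₂ (C₁ := CdynAbs) (C₂ := fun _ _ _ _ _ _ _ _ _ _ _ _ _ _ _ => True) one_pos one_pos ?_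
    (inFrame_dynAbs_of_fineScaleLLN h) EABirthCore.InFrame.of_true
  intro σ η₁ a₀ θ₀ u₀ T ρ θ u Φ ℓ τ a b φ _ _ _ _ _ _ _ _ _ _ _ _ _ _ _ _ _ _ _ c₁ _
  exact tendsto_of_tendsto_of_tendsto_of_le_of_le' tendsto_const_nhds c₁ (Eventually.of_forall fun N => bot_le)
    (Eventually.of_forall fun N => lintegral_mono fun z => ENNReal.ofReal_le_ofReal (le_abs_self _))

/-- **THE CRUX FOLLOWS FROM THE BOX-SCALE HYDRODYNAMIC LIMIT IN `L¹`**: `InFrame Cptlgfs → EntropyAdmissibility`. -/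
theorem crux_of_fineScaleLLN (h : InFrame Cptlgfs) : BoxDissipativeWeakStrong.EntropyAdmissibility :=
  crux_of_inFrame_dyn (inFrame_dyn_of_fineScaleLLN h)

/-- **The open heart S1b follows from the box-scale hydrodynamic limit in `L¹`**: `InFrame Cptlgfs → InFrame Cdef`. -/
theorem inFrame_def_of_fineScaleLLN (h : InFrame Cptlgfs) : InFrame Cdef :=
  inFrame_def_of_inFrame_dyn (inFrame_dyn_of_fineScaleLLN h)

/-! ## The registered bookkeeping stub -/

/-- Signature of the registered bookkeeping stub `stub_fineScaleBridge` (verbatim the skeleton's, r14). -/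
def Sig.stub_fineScaleBridge : Prop :=
  (InFrame Cptlgfs → InFrame CdynAbs) ∧ (InFrame Cptlgfs → BoxDissipativeWeakStrong.EntropyAdmissibility) ∧
    (InFrame Cptlgfs → InFrame Cdef)

/-- **Registered bookkeeping stub `stub_fineScaleBridge`** (crux stmt-AtomisticToContinuum-9903, line `registered`, r14): the crux
`EntropyAdmissibility`, its two-sided dynamic conclusion and its open heart S1b all follow from the box-scale hydrodynamic limit in
`L¹`. -/
theorem stub_fineScaleBridge : Sig.stub_fineScaleBridge :=
  ⟨inFrame_dynAbs_of_fineScaleLLN, crux_of_fineScaleLLN, inFrame_def_of_fineScaleLLN⟩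

end Summit.AtomisticToContinuum.HydrodynamicLimit.Theorems.EABirthFS

end
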